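import Summits.ResolutionOfSingularities.ResolutionOfSingularities.Theorems.PurelyInseparableDim4SwapTransportWindowResidual
import Summits.ResolutionOfSingularities.ResolutionOfSingularities.Theorems.PurelyInseparableDim4ResConeCInfVirtualEntryRotation
import Summits.ResolutionOfSingularities.ResolutionOfSingularities.Theorems.PurelyInseparableDim4ResConeCInfAssembly
import Summits.ResolutionOfSingularities.ResolutionOfSingularities.Theorems.PurelyInseparableDim4TschirnhausChain
import HarnessLib
import HarnessLib.Audit.Tags

/-!
# Purely inseparable four-folds — THE C∞ CONFIGURATION WITH ROTATIONS IS IMPOSSIBLE; `hN4` DISCHARGED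
# (cell `res-dim4-pi`, K2(p) lane, slice B; K24b-R1 closed)

[OURS · counted 0 · cell `res-dim4-pi` · K24b-R1 (res-dim4-typ-1 g3) over res-dim4-p-3 g4's entries (E0)
`ResCone.exists_cInf_virtual_entry_rel` (slot step) / `ResCone.exists_cInf_virtual_entry_of_rotation` (rotation); the
headline «K2(5) ⟺ slice C» is res-dim4-p-3 g4's K27e over this file and res-dim4-p-1 g4's `ResCone.twoSlot_slotT_residual`.]
Nothing here proves K2(p)/K2(5) (`NoAboveFloorTrap 5 5`), `NoIsolatedTrap 5 5` or resolution of singularities in dimension ≥ 4 /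
characteristic `p` — NOT proved: K2(5) becomes EQUIVALENT to the slice-C statement, which stays OPEN.  AI kernel work, weaker
than expert review.

* §1 **`cInf_no_chain`** — the binder block of `hN4` (isolated above-floor witnessed `Step0 5` chain with `x^{r₀} ∣ F₀`, shade
  `4` and `e_G = 3` from `k₀`, weights `≤ 1` of total `2`, both slots stretch-born from `k₁`; rotations ALLOWED) is
  contradictory: at `k′ = max k₂ k₁ + 1` the letters (`ResCone.exists_pair_letters`), births (`hborn`), power-cone package
  (`ResCone.chain_powerCone_package`), contact letter (`ResCone.contactSupport_not_subset_pair`), K11-lin ledger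
  (`ResCone.stretch_pair_ledger_linear`); the real step at `k′` is a slot step or a rotation (`step_cases_of_weights`) and
  res-dim4-p-3 g4's entry of the matching kind gives the framed virtual partner of `c (k′+1)`; then `cInf_no_chain_of_entry`
  (free-tail satellite, `virtual_iterate`, `virtual_window_false_at`, `ResCone.cInf_window_false`).
* §2 **`cInf_rotation_residual`** — the `hN4` binder of K27/K27c VERBATIM, discharged (`False.elim`).
* The headline «K2(5) ⟺ slice C with no presentation residual» is then res-dim4-p-3 g4's one-liner K27e
  `noAboveFloorTrap_five_iff_sliceC_of_rotation twoSlot_slotT_residual SwapTransport.cInf_rotation_residual` (not in this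
  file).
bears_on: LADDER-RESOLUTION:D157-DOOR2 (res-dim4-pi · K2(p) · slice B · K24b-R1 CLOSED).  Supports
stmt-ResolutionOfSingularities-16155 (helper).
-/

set_option linter.dupNamespace false -- mandated namespace of this single-conjunct summit

noncomputable section

namespace Summit.ResolutionOfSingularities.ResolutionOfSingularities.Theorems.PIDim4

namespace SwapTransport

open MvPolynomial Finset
open Literature.AlgebraicGeometry.Resolution
open Literature.AlgebraicGeometry.Resolution.CentreBlowup
open Literature.AlgebraicGeometry.Resolution.Hauser2010
open Literature.AlgebraicGeometry.Resolution.HauserPerlega2019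

variable {K : Type} [Field K] [CharP K 5] [DecidableEq K]

/-! ## §1 The C∞ configuration with rotations is impossible -/

/-- **NO C∞ CHAIN, ROTATIONS ALLOWED** (module docstring §1). [OURS] [cite: Hauser2010, §§F–G]
[cite: CossartJannsenSaito2020, Thm. 3.14] -/
theorem cInf_no_chain {c : ℕ → State K} {j : ℕ → Fin 4} {b : ℕ → Fin 4 → K}
    (hc : ∀ k, IsIsolated 5 (c k).F ∧ Step0 5 (c k) (c (k + 1))) (hw : FreeTail.IsWitnessedChain 5 c j b)
    (hr0 : ∀ e ∈ (c 0).F.support, (c 0).r ≤ e) (hfloor : ∀ k, ordZero (c k).F ≠ (5 : ℕ)) {k₀ : ℕ}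
    (hshade : ∀ k, k₀ ≤ k → (c k).shade = ((4 : ℕ) : ℕ∞))
    (he3 : ∀ k, k₀ ≤ k → Module.finrank K (ResCone.resVertex (c k)) = 3) {k₁ : ℕ} (hk₁ : k₀ ≤ k₁)
    (hwt : ∀ k, k₀ ≤ k → (∀ i, (c k).r i ≤ 1) ∧ (c k).r.degree = 2)
    (hborn : ∀ k, k₁ ≤ k → ∀ i, 1 ≤ (c k).r i →
      ∃ t, k₀ ≤ t ∧ t < k ∧ j t = i ∧ ∀ m, t < m → m < k → j m ≠ i ∧ b m i = 0) : False := by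
  haveI : Fact (Nat.Prime 5) := ⟨by norm_num⟩
  refine cInf_no_chain_of_entry hc hw hr0 hfloor hshade he3 hwt fun k₂ => ?_
  -- global facts and the power-cone package
  have hiso : ∀ k, IsIsolated 5 (c k).F := fun k => (hc k).1
  have ho6 : ∀ m, k₀ ≤ m → ordZero (c m).F = 6 := fun m hm => by
    obtain ⟨o, ho, -, -, hod⟩ := ResCone.chain_shade_nat 5 hc hfloor hshade hm
    rw [(hwt m hm).2] at hod
    have h6 : o = 6 := by omega
    rw [ho, h6]; rfl
  have hdiv : ∀ m, ∀ d ∈ (c m).F.support, (c m).r ≤ d := IsolatedBand.isolated_chain_forall_le hc hr0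
  have hbj : ∀ k, b k (j k) = 0 := fun k => (hw k).2.1
  obtain ⟨ℓ, a0, lam, hpkg⟩ := ResCone.chain_powerCone_package 5 hc hw hr0 hfloor (by norm_num) hshade he3
  have hform : ∀ k, k₀ ≤ k → ResCone.resForm (c k) = C (a0 k) * (∑ i, C (ℓ k i) * X i) ^ 4 :=
    fun k hk => (hpkg k hk).2.2.1
  have hdir : ∀ k, k₀ ≤ k → ℓ k (j k) + dotProduct (ℓ k) (b k) = 0 := fun k hk => (hpkg k hk).2.2.2.1
  have hlam : ∀ k, k₀ ≤ k → lam k ≠ 0 := fun k hk => (hpkg k hk).2.2.2.2.1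
  have hprop : ∀ k, k₀ ≤ k → ∀ i, i ≠ j k → ℓ (k + 1) i = lam k * ℓ k i := fun k hk => (hpkg k hk).2.2.2.2.2.1
  have hcarry : ∀ k, k₀ ≤ k → ∃ i, i ≠ j k ∧ ℓ k i ≠ 0 := fun k hk => (hpkg k hk).2.2.2.2.2.2
  -- the entry time `k′ = m + 1`
  obtain ⟨m, hm₂, hm₁⟩ : ∃ m, k₂ ≤ m ∧ k₁ ≤ m := ⟨max k₂ k₁, le_max_left _ _, le_max_right _ _⟩
  have hk'₁ : k₁ ≤ m + 1 := by omega
  have hk'₀ : k₀ ≤ m + 1 := by omega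
  -- (1) letters and births at `k′`
  obtain ⟨la, mu, hlm, hr'⟩ := ResCone.exists_pair_letters (hwt (m + 1) hk'₀).1 (hwt (m + 1) hk'₀).2
  obtain ⟨ta, hta, htak, hja, hkepta⟩ := hborn (m + 1) hk'₁ la (Nat.one_le_iff_ne_zero.mpr (by
    rw [hr', Finsupp.add_apply, Finsupp.single_eq_same, Finsupp.single_eq_of_ne hlm]; omega))
  obtain ⟨tb, htb, htbk, hjb, hkeptb⟩ := hborn (m + 1) hk'₁ mu (Nat.one_le_iff_ne_zero.mpr (by
    rw [hr', Finsupp.add_apply, Finsupp.single_eq_of_ne (Ne.symm hlm), Finsupp.single_eq_same]; omega))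
  -- (2) the contact letter `f` (K13b) and the fourth letter `u`
  have hf : ∃ f : Fin 4, f ≠ la ∧ f ≠ mu ∧ ℓ (m + 1) f ≠ 0 := by
    rcases Nat.lt_or_gt_of_ne (show ta ≠ tb from fun h => hlm (by rw [← hja, ← hjb, h])) with hlt | hlt
    · obtain ⟨e, h1, h2, h3⟩ := ResCone.contactSupport_not_subset_pair hdir hlam hprop hcarry hbj hta hlt htbk
        (fun n hn hnk => by rw [hja]; exact hkepta n hn hnk) (fun n hn hnk => by rw [hjb]; exact hkeptb n hn hnk)
      exact ⟨e, by rw [← hja]; exact h1, by rw [← hjb]; exact h2, h3⟩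
    · obtain ⟨e, h1, h2, h3⟩ := ResCone.contactSupport_not_subset_pair hdir hlam hprop hcarry hbj htb hlt htak
        (fun n hn hnk => by rw [hjb]; exact hkeptb n hn hnk) (fun n hn hnk => by rw [hja]; exact hkepta n hn hnk)
      exact ⟨e, by rw [← hja]; exact h2, by rw [← hjb]; exact h1, h3⟩
  obtain ⟨f, hfl, hfm, hℓf⟩ := hf
  obtain ⟨u, hul, hum, huf, -⟩ := ResCone.exists_fourth_letter hlm hfl.symm hfm.symm
  -- (3) the K11-lin ledger identity at `k′`
  obtain ⟨U, S, T, hU, hledger⟩ := ResCone.stretch_pair_ledger_linear 5 hc hw hr0 hfloor (by norm_num : 1 ≤ 4) hshade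
    hform hdir hlam hprop hcarry hlm hfl hfm hℓf hta htak hja hkepta htb htbk hjb hkeptb
  -- (4) readings of `c k′` and `c (k′+1)`
  obtain ⟨-, -, -, -, hcm⟩ := hw m
  have hclean : deletePthPowers 5 (c (m + 1)).F = (c (m + 1)).F := by
    rw [hcm]; exact FrameChange.deletePthPowers_step_F 5 Finset.univ (j m) (b m) (c m)
  obtain ⟨-, hbjm, -, -, hcs⟩ := hw (m + 1)
  have hoA' : ordZero (c (m + 1)).F = ((6 : ℕ) : ℕ∞) := by exact_mod_cast ho6 (m + 1) hk'₀
  have hoA : ordZero (c (m + 1 + 1)).F = ((6 : ℕ) : ℕ∞) := by exact_mod_cast ho6 (m + 1 + 1) (by omega)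
  have he3A : Module.finrank K (ResCone.resVertex (c (m + 1 + 1))) = 3 := he3 (m + 1 + 1) (by omega)
  obtain ⟨Nc, hcert⟩ := IsolationConverse.exists_certificate_of_isIsolated (hiso (m + 1 + 1))
  have hw1 : ∀ i, (CentreBlowup.step 5 Finset.univ (j (m + 1)) (b (m + 1)) (c (m + 1))).r i ≤ 1 := fun i => by
    rw [← hcs]; exact (hwt (m + 1 + 1) (by omega)).1 i
  have hdeg : (CentreBlowup.step 5 Finset.univ (j (m + 1)) (b (m + 1)) (c (m + 1))).r.degree = 2 := by
    rw [← hcs]; exact (hwt (m + 1 + 1) (by omega)).2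
  -- (5) the real step at `k′`: slot step (either chart) or rotation (either slot dropped)
  rcases step_cases_of_weights hlm hul.symm hfl.symm hum.symm hfm.symm huf hr' (ho6 (m + 1) hk'₀) hw1 hdeg with
    ⟨hjr, hbmu, hrA⟩ | ⟨hjr, hbla, hrA⟩ | ⟨hjr, hrot⟩
  · -- slot step in the chart of `λ`
    have hbla : b (m + 1) la = 0 := by rw [← hjr]; exact hbjm
    have hA : c (m + 1 + 1) = CentreBlowup.step 5 Finset.univ la (b (m + 1)) (c (m + 1)) := by rw [← hjr]; exact hcs
    have hrA2 : (c (m + 1 + 1)).r = Finsupp.single la 1 + Finsupp.single mu 1 := by rw [hcs]; exact hrA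
    exact ⟨m + 1 + 1, by omega, la, mu, u, f, 1, hlm, hul.symm, hfl.symm, hum.symm, hfm.symm, huf, hrA2,
      ResCone.exists_cInf_virtual_entry_rel hlm hul.symm hfl.symm hum.symm hfm.symm huf (Or.inl rfl) hbla hbla hbmu hA
        hr' hrA2 (hdiv (m + 1)) (hdiv (m + 1 + 1)) hoA' hoA hclean (hiso (m + 1 + 1)) he3A (hform (m + 1) hk'₀) hℓf hU
        hledger⟩
  · -- slot step in the chart of `μ`
    have hbmu : b (m + 1) mu = 0 := by rw [← hjr]; exact hbjm
    have hA : c (m + 1 + 1) = CentreBlowup.step 5 Finset.univ mu (b (m + 1)) (c (m + 1)) := by rw [← hjr]; exact hcs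
    have hrA2 : (c (m + 1 + 1)).r = Finsupp.single la 1 + Finsupp.single mu 1 := by rw [hcs]; exact hrA
    exact ⟨m + 1 + 1, by omega, la, mu, u, f, 1, hlm, hul.symm, hfl.symm, hum.symm, hfm.symm, huf, hrA2,
      ResCone.exists_cInf_virtual_entry_rel hlm hul.symm hfl.symm hum.symm hfm.symm huf (Or.inr rfl) hbmu hbla hbmu hA
        hr' hrA2 (hdiv (m + 1)) (hdiv (m + 1 + 1)) hoA' hoA hclean (hiso (m + 1 + 1)) he3A (hform (m + 1) hk'₀) hℓf hU
        hledger⟩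
  · -- rotation through the free letter `g = j k′`
    obtain ⟨g, gt, hg, hjg⟩ : ∃ g gt : Fin 4, ((g = u ∧ gt = f) ∨ (g = f ∧ gt = u)) ∧ j (m + 1) = g := by
      rcases hjr with h | h
      · exact ⟨u, f, Or.inl ⟨rfl, rfl⟩, h⟩
      · exact ⟨f, u, Or.inr ⟨rfl, rfl⟩, h⟩
    have hbg : b (m + 1) g = 0 := by rw [← hjg]; exact hbjm
    have hA : c (m + 1 + 1) = CentreBlowup.step 5 Finset.univ g (b (m + 1)) (c (m + 1)) := by rw [← hjg]; exact hcs
    have hlg : la ≠ g := by rcases hg with ⟨rfl, -⟩ | ⟨rfl, -⟩ <;> [exact hul.symm; exact hfl.symm]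
    have hmg : mu ≠ g := by rcases hg with ⟨rfl, -⟩ | ⟨rfl, -⟩ <;> [exact hum.symm; exact hfm.symm]
    rcases hrot with ⟨hbla, hbmu, hrA⟩ | ⟨hbmu, hbla, hrA⟩
    · -- the slot `λ` is translated away
      have hrA2 : (c (m + 1 + 1)).r = Finsupp.single g 1 + Finsupp.single mu 1 := by rw [hcs, ← hjg]; exact hrA
      refine ⟨m + 1 + 1, by omega, la, mu, u, f, Equiv.swap la g, hlm, hul.symm, hfl.symm, hum.symm, hfm.symm, huf, ?_,
        fun M N => ResCone.exists_cInf_virtual_entry_of_rotation hlm hul.symm hfl.symm hum.symm hfm.symm huf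
          (Or.inl ⟨rfl, rfl⟩) hg hbg hbla hbmu hA hr' (hdiv (m + 1)) hoA' hclean (hiso (m + 1 + 1)) hcert hoA he3A hrA2
          (hdiv (m + 1 + 1)) (hform (m + 1) hk'₀) hℓf hU hledger M N⟩
      rw [Equiv.swap_apply_left, Equiv.swap_apply_of_ne_of_ne hlm.symm hmg]; exact hrA2
    · -- the slot `μ` is translated away
      have hrA2 : (c (m + 1 + 1)).r = Finsupp.single g 1 + Finsupp.single la 1 := by rw [hcs, ← hjg]; exact hrA
      refine ⟨m + 1 + 1, by omega, la, mu, u, f, Equiv.swap mu g, hlm, hul.symm, hfl.symm, hum.symm, hfm.symm, huf, ?_,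
        fun M N => ResCone.exists_cInf_virtual_entry_of_rotation hlm hul.symm hfl.symm hum.symm hfm.symm huf
          (Or.inr ⟨rfl, rfl⟩) hg hbg hbmu hbla hA hr' (hdiv (m + 1)) hoA' hclean (hiso (m + 1 + 1)) hcert hoA he3A hrA2
          (hdiv (m + 1 + 1)) (hform (m + 1) hk'₀) hℓf hU hledger M N⟩
      rw [Equiv.swap_apply_of_ne_of_ne hlm hlg, Equiv.swap_apply_left]; exact hrA2.trans (add_comm _ _)

/-! ## §2 `hN4` discharged -/

/-- **THE RE-PRESENTATION RESIDUAL `hN4` OF K27/K27c, DISCHARGED**: its binder block is contradictory (`cInf_no_chain`), so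
the re-presented chain exists vacuously. [OURS] -/
theorem cInf_rotation_residual : ∀ (K : Type) [Field K] [CharP K 5] [DecidableEq K] (c : ℕ → State K) (j : ℕ → Fin 4)
    (b : ℕ → Fin 4 → K), (∀ k, IsIsolated 5 (c k).F ∧ Step0 5 (c k) (c (k + 1))) →
    FreeTail.IsWitnessedChain 5 c j b → (∀ e ∈ (c 0).F.support, (c 0).r ≤ e) →
    (∀ k, ordZero (c k).F ≠ (5 : ℕ)) → ∀ k₀ : ℕ, (∀ k, k₀ ≤ k → (c k).shade = ((4 : ℕ) : ℕ∞)) →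
    (∀ k, k₀ ≤ k → Module.finrank K (ResCone.resVertex (c k)) = 3) →
    ∀ k₁ : ℕ, k₀ ≤ k₁ → (∀ k, k₀ ≤ k → (∀ i, (c k).r i ≤ 1) ∧ (c k).r.degree = 2) →
    (∀ k, k₁ ≤ k → ∀ i, 1 ≤ (c k).r i →
      ∃ t, k₀ ≤ t ∧ t < k ∧ j t = i ∧ ∀ m, t < m → m < k → j m ≠ i ∧ b m i = 0) →
    ∃ (c' : ℕ → State K) (j' : ℕ → Fin 4) (b' : ℕ → Fin 4 → K) (k₀' k₁' : ℕ),
      (∀ k, IsIsolated 5 (c' k).F ∧ Step0 5 (c' k) (c' (k + 1))) ∧ FreeTail.IsWitnessedChain 5 c' j' b' ∧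
      (∀ e ∈ (c' 0).F.support, (c' 0).r ≤ e) ∧ (∀ k, ordZero (c' k).F ≠ (5 : ℕ)) ∧
      (∀ k, k₀' ≤ k → (c' k).shade = ((4 : ℕ) : ℕ∞)) ∧
      (∀ k, k₀' ≤ k → Module.finrank K (ResCone.resVertex (c' k)) = 3) ∧ k₀' ≤ k₁' ∧
      (∀ k, k₀' ≤ k → (∀ i, (c' k).r i ≤ 1) ∧ (c' k).r.degree = 2) ∧
      (∀ k, k₁' ≤ k → ∀ i, 1 ≤ (c' k).r i →
        ∃ t, k₀' ≤ t ∧ t < k ∧ j' t = i ∧ ∀ m, t < m → m < k → j' m ≠ i ∧ b' m i = 0) ∧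
      (∀ k, k₁' ≤ k → 1 ≤ (c' k).r (j' k)) :=
  fun _ _ _ _ _ _ _ hc hw hr0 hfloor _ hshade he3 _ hk₁ hwt hborn =>
    (cInf_no_chain hc hw hr0 hfloor hshade he3 hk₁ hwt hborn).elim

end SwapTransport

end Summit.ResolutionOfSingularities.ResolutionOfSingularities.Theorems.PIDim4

end
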